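import Literature.NumberTheory.GaloisRepresentations.IdeleClassBarSRelativeInvariant
import Literature.Algebra.Homology.DiscreteRepTateDualityPrimary
import HarnessLib

/-!
# The axiom `inv_U ∘ Res = [G_S : U] · inv_S` for the `S`-idèle class formation and the fields `invAt_injective`,
# `exists_invAt_eq`, `ext_triv_divisible` (`r = 2`), `ext_one_eq_zero` of `TateDualityHypothesesAt p (C̄_S) inv_S`
# at every open normal subgroup `U ≤ G_S` (Harari Thm. 17.2, Remark 16.24 (b), 17.1; Milne ADT I §1, §4)

Topic `NumberTheory/GaloisRepresentations`; namespace `Literature.NumberTheory.GaloisRepresentations.IdeleClassBar`.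
One definition with body (`invSAt`, the descended invariant map at an open subgroup) and theorems; NO named fact, no
instance, no notation, no `sorry`; number fields in `Type`.  Sequel to this seat's `IdeleClassBarSInvariant` (`invS S = inv_S`
on `Ext²_{C_{G_S}}(ℤ, C̄_S)`: injective, layer values, `p`-power torsion) and `IdeleClassBarSRelativeInvariant` (the relative
layer invariants `relLayerInvS` at an open `W ≤ G_S`: injective, ranges, `relLayerInvS_map_traceQuotMap` = the finite-level
`Res`-axiom, compatibility with `stepG`), to bsd-line-x1-p1-w7's
`DiscreteRepLayerInvariantsPrimary` (`inv_comp_extCores_eq_of_exists`: `inv_Γ ∘ cores_U = inv_U` for a `P`-class formation;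
`exists_desc_eq_of_pow_nsmul_eq_zero`, `exists_eq_nsmul_of_layers`, `ext_one_eq_zero_of_layers`),
`RestrictedRamificationLayerIndexPPower` (`p^∞ ∣ [W : V̄_E ∩ W]` along the layers when `S ⊇ S_p`) and
`DiscreteRepTateDualityPrimary` (`DiscreteRep.invAt C inv U := inv ∘ cores_U`, the structure `TateDualityHypothesesAt`).

THE POINT.  §0: the relative layer invariants form a compatible family over the cofinal trace layers of an open `W ≤ G_S`
and descend to **`invSAt S W hW : Ext²_{C_W}(ℤ, Res_W C̄_S) →+ ℚ/ℤ`** (injective, values on inflated classes, range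
`⋃_E (1/|H_E|)ℤ/ℤ`).  For an open normal subgroup `U ≤ G_S` the engine's local invariant map is `invAt C̄_S inv_S U = inv_S ∘ cores_U`
(Milne I §1 (1.1)); for a `P`-class formation (`inv_S` injective, NOT onto `ℚ/ℤ`) door-c4's `bijective_inv_comp_extCores` is
not available, and w7's replacement `inv_comp_extCores_eq_of_exists` needs: (i) the `Res`-axiom **`inv_U (Res x) = [G_S : U] ·
inv_S (x)`** (§1 `invSAt_extRes`: write `x = Inf_E c`, read `Res` on the layers by door-c4's `extRes_inflG`, and use the
finite-level axiom `inv_{H_E} ∘ res = [Gal(E/K) : H_E] · inv_{E/K,S}` with `[Gal(E/K) : H_E] = [G_S : U]`), (ii) `inv_U`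
injective (✓), (iii) every value of `inv_U` is `[G_S:U]` times a value of `inv_S` (§1 `exists_invSAt_eq_index_nsmul_invS`:
both ranges are `⋃_E (1/|H_E|)ℤ/ℤ` resp. `⋃_E (1/[E:K])ℤ/ℤ` and `[E:K] = |H_E| · [G_S:U]`).  HENCE (§2) **`invAt (classBarSD K S)
(invS S) U = invSAt S ↑U`**, and the four fields of `TateDualityHypothesesAt p (classBarSD K S) (invS S)` owned by this brick:
**`invAt_injective`**, **`exists_invAt_eq`** (`p`-power torsion, `S ⊇ S_p`), **`ext_triv_divisible` for `r = 2`** and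
**`ext_one_eq_zero`**, at EVERY open normal `U` (the engine's quantifier).  The remaining fields (`r ≥ 3`:
bsd-line-x1-p1-w4's D2-TN; `adjointBijective_one_zmod_pow`: bsd-line-x1-p1-w8's D2-(b); `baer`, `prime`,
`ext_one_triv_eq_zero`: w7's constructor) are NOT here.

Cell `bsd-eis`, background lane «PT-Ш-S-TC» of crux `GoodLatticeBDPValue` (stmt-BirchSwinnertonDyer-19032), brick D2-CF,
seat bsd-line-x1-p1-w5 g10.  HONEST FRAMING: classical class field theory in the tree's normalisation; no duality theorem,
no case of Poitou–Tate and no case of BSD is proved here.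

## References
* D. Harari, *Galois Cohomology and Class Field Theory* (2020), §16.1 Def. 16.3, §16.4 Remark 16.24 (b), §17.1 Remark 17.1,
  Thm. 17.2. [Harari2020]
* J. S. Milne, *Arithmetic Duality Theorems* (2nd ed. 2006), I §1 (class formations, (1.1)), I §4. [MilneADT2006]
* J.-P. Serre, *Local Fields*, GTM 67 (1979), XI §2 Proposition 1, §3. [SerreLocalFields1979]
* J.-P. Serre, *Galois Cohomology* (1997), I §2.2 Proposition 8. [SerreGaloisCohomology1997]
-/

noncomputable section

open NumberField IsDedekindDomain CategoryTheory CategoryTheory.Limits groupCohomology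
open Field (absoluteGaloisGroup)
open Literature.NumberTheory.Automorphic Literature.NumberTheory.Automorphic.IdeleClassGroup
open Literature.NumberTheory.NumberFields
open Literature.Algebra.Homology Literature.Algebra.Homology.DiscreteRep
open Literature.NumberTheory.GaloisRepresentations.LocalWeilDatum (galFixing)
open scoped Classical

namespace Literature.NumberTheory.GaloisRepresentations

namespace IdeleClassBar

variable {K : Type} [Field K] [NumberField K] (S : Finset (HeightOneSpectrum (𝓞 K)))

/-! ## §0. The invariant map at an open subgroup: `inv_W : Ext²_{C_W}(ℤ, Res_W C̄_S) →+ ℚ/ℤ` -/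

section Subgroup

variable (W : Subgroup (GaloisGroupUnramifiedOutside K (↑S : Set (HeightOneSpectrum (𝓞 K)))))
  (hW : IsOpen (W : Set (GaloisGroupUnramifiedOutside K (↑S : Set (HeightOneSpectrum (𝓞 K))))))

/-- **The index set of the relative layers at `W`**: the layers `E ⊂ K_S` with `V̄_E ≤ W` (for `W = Gal(K_S/L)`: `E ⊇ L`).
[cite: SerreGaloisCohomology1997, I §2.2 Proposition 8] -/
abbrev RelLayerKS : Type :=
  {E : LayerKS S // (layerSubgroupS S E.1 : Subgroup (GaloisGroupUnramifiedOutside K (↑S : Set (HeightOneSpectrum (𝓞 K))))) ≤ W}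

/-- The trace layer of a relative layer (door-c4's `traceOpenNormalSubgroup`). [cite: SerreGaloisCohomology1997, I §2.2 Proposition 8] -/
abbrev relTraceS (E : RelLayerKS S W) : OpenNormalSubgroup W :=
  DiscreteRep.traceOpenNormalSubgroup W (layerSubgroupS S E.1.1)

variable {W} in
/-- Comparison of traces detects the order: `V̄_{E'} ∩ W ≤ V̄_E ∩ W` with `V̄_{E'} ≤ W`, `E ⊂ K_S` gives `E ≤ E'`.
[cite: SerreGaloisCohomology1997, I §2.2 Proposition 8] -/
theorem le_of_relTraceS_le {E E' : GalLayer K}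
    (hE : ramificationSubgroup K (↑S : Set (HeightOneSpectrum (𝓞 K))) ≤ galFixing K E.1)
    (hE'W : (layerSubgroupS S E' : Subgroup (GaloisGroupUnramifiedOutside K (↑S : Set (HeightOneSpectrum (𝓞 K))))) ≤ W)
    (h : (DiscreteRep.traceOpenNormalSubgroup W (layerSubgroupS S E') : Subgroup W) ≤
      DiscreteRep.traceOpenNormalSubgroup W (layerSubgroupS S E)) : E ≤ E' := by
  refine le_of_layerSubgroupS_le S hE fun g hg => ?_
  have hgW : g ∈ W := hE'W hg
  exact (DiscreteRep.mem_traceOpenNormalSubgroup_iff W (layerSubgroupS S E) ⟨g, hgW⟩).1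
    (h ((DiscreteRep.mem_traceOpenNormalSubgroup_iff W (layerSubgroupS S E') ⟨g, hgW⟩).2 hg))

include hW in
/-- **The relative invariants form a compatible family on the cofinal family of trace layers of `W`** (`W` open, `G_S`
profinite: cofinality by door-c6's `exists_traceOpenNormalSubgroup_le` and w3's `exists_layerSubgroupS_le`; compatibility
`relLayerInvS_stepG`). [cite: SerreGaloisCohomology1997, I §2.2 Proposition 8][cite: SerreLocalFields1979, Ch. XI §3] -/
theorem isCompatibleFamily_relLayerInvS
    [TotallyDisconnectedSpace (GaloisGroupUnramifiedOutside K (↑S : Set (HeightOneSpectrum (𝓞 K))))] :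
    LayerColimit.IsCompatibleFamily (relTraceS S W) ((DiscreteRep.resD ℤ W).obj (classBarSD K S)) 2
      (fun E => relLayerInvS S E.1.2 E.2) := by
  refine ⟨fun W' => ?_, fun E E' h c => ?_⟩
  · obtain ⟨V, hVW, hVW'⟩ := DiscreteRep.exists_traceOpenNormalSubgroup_le W hW W'
    obtain ⟨E, hE, hEV⟩ := exists_layerSubgroupS_le S V
    exact ⟨⟨⟨E, hE⟩, hEV.trans hVW⟩, (DiscreteRep.traceOpenNormalSubgroup_mono W hEV).trans hVW'⟩
  · exact relLayerInvS_stepG S E.1.2 E.2 (le_of_relTraceS_le S E.1.2 E'.2 h) E'.1.2 E'.2 c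

/-- **THE invariant map of the `S`-idèle class formation at an open subgroup, `inv_W : Ext²_{C_W}(ℤ, Res_W C̄_S) →+ ℚ/ℤ`** —
the descent to door-c4's colimit for the group `↥W` of the invariants of the relative layers.
[cite: SerreLocalFields1979, Ch. XI §3][cite: Harari2020, §16.1 Def. 16.3, §17.1 Thm. 17.2][cite: MilneADT2006, I §1] -/
def invSAt :
    Abelian.Ext (triv (k := ℤ) (Γ := W) ℤ) ((DiscreteRep.resD ℤ W).obj (classBarSD K S)) 2 →+ AddCircle (1 : ℚ) :=
  haveI := totallyDisconnectedSpace_GS S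
  haveI : CompactSpace W := LayerColimit.compactSpace_subgroup_of_isOpen W hW
  LayerColimit.desc (relTraceS S W) ((DiscreteRep.resD ℤ W).obj (classBarSD K S)) 2 (fun E => relLayerInvS S E.1.2 E.2)
    (isCompatibleFamily_relLayerInvS S W hW)

variable {W}

/-- **`inv_W (Inf c) = relLayerInvS_E c`** on a class inflated from the trace layer `V̄_E ∩ W` (`V̄_E ≤ W`).
[cite: SerreLocalFields1979, Ch. XI §3][cite: SerreGaloisCohomology1997, I §2.2 Proposition 8] -/
theorem invSAt_inflG {E : GalLayer K} (hE : ramificationSubgroup K (↑S : Set (HeightOneSpectrum (𝓞 K))) ≤ galFixing K E.1)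
    (hEW : (layerSubgroupS S E : Subgroup (GaloisGroupUnramifiedOutside K (↑S : Set (HeightOneSpectrum (𝓞 K))))) ≤ W)
    (c : groupCohomology (relLayerRepS S W E) 2) :
    (haveI := totallyDisconnectedSpace_GS S; haveI : CompactSpace W := LayerColimit.compactSpace_subgroup_of_isOpen W hW;
      invSAt S W hW (LayerColimit.inflG (DiscreteRep.traceOpenNormalSubgroup W (layerSubgroupS S E))
        ((DiscreteRep.resD ℤ W).obj (classBarSD K S)) 2 c)) = relLayerInvS S hE hEW c :=
  haveI := totallyDisconnectedSpace_GS S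
  haveI : CompactSpace W := LayerColimit.compactSpace_subgroup_of_isOpen W hW
  LayerColimit.desc_inflG (isCompatibleFamily_relLayerInvS S W hW) ⟨⟨E, hE⟩, hEW⟩ c

/-- On a class inflated from an arbitrary open normal `W' ≤ ↥W`: `inv_W (Inf c) = relLayerInvS_E (stepG c)` for any relative layer
`E` whose trace lies in `W'`. [cite: SerreGaloisCohomology1997, I §2.2 Proposition 8] -/
theorem invSAt_inflG_of_le (W' : OpenNormalSubgroup W) {E : GalLayer K}
    (hE : ramificationSubgroup K (↑S : Set (HeightOneSpectrum (𝓞 K))) ≤ galFixing K E.1)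
    (hEW : (layerSubgroupS S E : Subgroup (GaloisGroupUnramifiedOutside K (↑S : Set (HeightOneSpectrum (𝓞 K))))) ≤ W)
    (hle : (DiscreteRep.traceOpenNormalSubgroup W (layerSubgroupS S E) : Subgroup W) ≤ W')
    (c : groupCohomology ((invariantsQuotFunctor ℤ (W' : Subgroup W)).obj ((DiscreteRep.resD ℤ W).obj (classBarSD K S))) 2) :
    (haveI := totallyDisconnectedSpace_GS S; haveI : CompactSpace W := LayerColimit.compactSpace_subgroup_of_isOpen W hW;
      invSAt S W hW (LayerColimit.inflG W' ((DiscreteRep.resD ℤ W).obj (classBarSD K S)) 2 c)) =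
      relLayerInvS S hE hEW (LayerColimit.stepG W' (DiscreteRep.traceOpenNormalSubgroup W (layerSubgroupS S E)) hle
        ((DiscreteRep.resD ℤ W).obj (classBarSD K S)) 2 c) :=
  haveI := totallyDisconnectedSpace_GS S
  haveI : CompactSpace W := LayerColimit.compactSpace_subgroup_of_isOpen W hW
  LayerColimit.desc_inflG_of_le (isCompatibleFamily_relLayerInvS S W hW) W' (i := ⟨⟨E, hE⟩, hEW⟩) hle c

/-- **`inv_W` is injective** (each `relLayerInvS_E` is). [cite: SerreLocalFields1979, Ch. XI §2 Proposition 1] -/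
theorem invSAt_injective : Function.Injective (invSAt S W hW) :=
  haveI := totallyDisconnectedSpace_GS S
  haveI : CompactSpace W := LayerColimit.compactSpace_subgroup_of_isOpen W hW
  LayerColimit.desc_injective (isCompatibleFamily_relLayerInvS S W hW) fun E => relLayerInvS_injective S E.1.2 E.2

/-- **Every value of `inv_W` is a layer value**: `inv_W y ∈ (1/|H_E|)ℤ/ℤ` for some relative layer `E` — the range of `inv_W` is
`⋃_E (1/|H_E|)ℤ/ℤ`. [cite: SerreLocalFields1979, Ch. XI §3][cite: Harari2020, §16.4 Remark 16.24 (b)] -/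
theorem exists_natCard_nsmul_invSAt_eq_zero
    (y : Abelian.Ext (triv (k := ℤ) (Γ := W) ℤ) ((DiscreteRep.resD ℤ W).obj (classBarSD K S)) 2) :
    ∃ (E : GalLayer K) (hE : ramificationSubgroup K (↑S : Set (HeightOneSpectrum (𝓞 K))) ≤ galFixing K E.1),
      (layerSubgroupS S E : Subgroup (GaloisGroupUnramifiedOutside K (↑S : Set (HeightOneSpectrum (𝓞 K))))) ≤ W ∧
        Nat.card (subgroupImageS S hE W) • invSAt S W hW y = 0 := by
  haveI := totallyDisconnectedSpace_GS S
  haveI : CompactSpace W := LayerColimit.compactSpace_subgroup_of_isOpen W hW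
  obtain ⟨E, c, rfl⟩ := (isCompatibleFamily_relLayerInvS S W hW).exists_inflG_eq y
  refine ⟨E.1.1, E.1.2, E.2, ?_⟩
  rw [invSAt_inflG S hW E.1.2 E.2]
  exact (mem_range_relLayerInvS_iff S E.1.2 E.2 _).1 ⟨c, rfl⟩

end Subgroup

/-! ## §1. `inv_U ∘ Res = [G_S : U] · inv_S` and the comparison of the ranges -/

/-- Every element of `ℚ/ℤ` killed by `N ≥ 1` is an integer multiple of `1/N`. [folklore] -/
private theorem exists_zsmul_oneDiv_eq {N : ℕ} (hN : 0 < N) (t : AddCircle (1 : ℚ)) (ht : N • t = 0) :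
    ∃ r : ℤ, r • oneDiv N = t := by
  induction t using QuotientAddGroup.induction_on with
  | H q =>
    have hN' : (N : ℚ) ≠ 0 := Nat.cast_ne_zero.2 hN.ne'
    have h : ((N • q : ℚ) : AddCircle (1 : ℚ)) = 0 := by rw [AddCircle.coe_nsmul]; exact ht
    obtain ⟨m, hm⟩ := (AddCircle.coe_eq_zero_iff (1 : ℚ)).1 h
    rw [zsmul_eq_mul, mul_one, nsmul_eq_mul] at hm
    refine ⟨m, ?_⟩
    rw [zsmul_oneDiv]
    congr 1
    rw [hm, mul_div_cancel_left₀ _ hN']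

/-- **`inv_U (Res x) = [G_S : U] · inv_S (x)`** for every `x ∈ Ext²_{C_{G_S}}(ℤ, C̄_S)` and `U ≤ G_S` open normal: write
`x = Inf_E c` with `V̄_E ≤ U`; then `Res x = Inf_{V̄_E ∩ U} (Hⁿ(traceQuotMap, traceLayerHom) c)` (door-c4 `extRes_inflG`), whose
`inv_U` is `inv_{H_E} (res_{H_E} (iso c)) = [Gal(E/K) : H_E] · inv_{E/K,S} (iso c)` (this seat's `relLayerInvS_map_traceQuotMap`),
and `[Gal(E/K) : H_E] = [G_S : U]`, `inv_{E/K,S} (iso c) = inv_S (Inf_E c)`.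
[cite: SerreLocalFields1979, Ch. XI §2 Proposition 1][cite: MilneADT2006, I §1 (1.1)][cite: Harari2020, §16.1 Def. 16.3] -/
theorem invSAt_extRes (U : OpenNormalSubgroup (GaloisGroupUnramifiedOutside K (↑S : Set (HeightOneSpectrum (𝓞 K)))))
    (x : Abelian.Ext (triv (k := ℤ) (Γ := GaloisGroupUnramifiedOutside K (↑S : Set (HeightOneSpectrum (𝓞 K)))) ℤ)
      (classBarSD K S) 2) :
    invSAt S (U : Subgroup (GaloisGroupUnramifiedOutside K (↑S : Set (HeightOneSpectrum (𝓞 K))))) U.toOpenSubgroup.isOpen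
        (extRes (U : Subgroup (GaloisGroupUnramifiedOutside K (↑S : Set (HeightOneSpectrum (𝓞 K)))))
          (triv (k := ℤ) (Γ := GaloisGroupUnramifiedOutside K (↑S : Set (HeightOneSpectrum (𝓞 K)))) ℤ) (classBarSD K S) 2 x) =
      (U : Subgroup (GaloisGroupUnramifiedOutside K (↑S : Set (HeightOneSpectrum (𝓞 K))))).index • invS S x := by
  haveI := totallyDisconnectedSpace_GS S
  -- `x = Inf_E c` with `V̄_E ≤ W ⊓ U`
  obtain ⟨W, c₀, rfl⟩ := LayerColimit.exists_inflG_eq 2 (classBarSD K S) x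
  obtain ⟨E, hE, hEWU⟩ := exists_layerSubgroupS_le S (W ⊓ U)
  have hEW : (layerSubgroupS S E : Subgroup (GaloisGroupUnramifiedOutside K (↑S : Set (HeightOneSpectrum (𝓞 K))))) ≤ W :=
    hEWU.trans (LayerColimit.coe_le_coe_of_le inf_le_left)
  have hEU : (layerSubgroupS S E : Subgroup (GaloisGroupUnramifiedOutside K (↑S : Set (HeightOneSpectrum (𝓞 K))))) ≤ U :=
    hEWU.trans (LayerColimit.coe_le_coe_of_le inf_le_right)
  rw [← LayerColimit.inflG_stepG W (layerSubgroupS S E) hEW _ 2 c₀]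
  set c := LayerColimit.stepG W (layerSubgroupS S E) hEW (classBarSD K S) 2 c₀
  rw [LayerColimit.extRes_inflG, invSAt_inflG S _ hE hEU, relLayerInvS_map_traceQuotMap S hE hEU c, invS_inflG S hE]

/-- **Every value of `inv_U` is `[G_S : U]` times a value of `inv_S`**: for `y ∈ Ext²_{C_U}(ℤ, Res_U C̄_S)`, `inv_U y = r/|H_E|` for
some relative layer `E` (`V̄_E ≤ U`), and `r/|H_E| = [G_S:U] · (r/[E:K])` with `r/[E:K]` a value of `inv_{E/K,S}`, since
`[E:K] = [G_S : U] · |H_E|` — the third hypothesis of w7's `inv_comp_extCores_eq_of_exists` (in a `P`-class formation both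
ranges are `{q : ord q ∣ a layer degree}`). [cite: Harari2020, §16.4 Remark 16.24 (b)][cite: SerreLocalFields1979, Ch. XI §3] -/
theorem exists_invSAt_eq_index_nsmul_invS
    (U : OpenNormalSubgroup (GaloisGroupUnramifiedOutside K (↑S : Set (HeightOneSpectrum (𝓞 K)))))
    (y : Abelian.Ext (triv (k := ℤ) (Γ := (U : Subgroup (GaloisGroupUnramifiedOutside K (↑S : Set (HeightOneSpectrum (𝓞 K)))))) ℤ)
      ((DiscreteRep.resD ℤ (U : Subgroup (GaloisGroupUnramifiedOutside K (↑S : Set (HeightOneSpectrum (𝓞 K)))))).obj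
        (classBarSD K S)) 2) :
    ∃ x, invSAt S (U : Subgroup (GaloisGroupUnramifiedOutside K (↑S : Set (HeightOneSpectrum (𝓞 K))))) U.toOpenSubgroup.isOpen y =
      (U : Subgroup (GaloisGroupUnramifiedOutside K (↑S : Set (HeightOneSpectrum (𝓞 K))))).index • invS S x := by
  haveI := totallyDisconnectedSpace_GS S
  obtain ⟨E, hE, hEU, hq⟩ := exists_natCard_nsmul_invSAt_eq_zero S U.toOpenSubgroup.isOpen y
  haveI := E.finiteDimensional
  haveI := E.isGalois
  have hcard : 0 < Nat.card (subgroupImageS S hE (U : Subgroup (GaloisGroupUnramifiedOutside K (↑S : Set (HeightOneSpectrum (𝓞 K)))))) :=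
    Nat.card_pos
  obtain ⟨r, hr⟩ := exists_zsmul_oneDiv_eq hcard _ hq
  -- a class of the layer `E` with invariant `r/[E:K]`
  have hmem : r • oneDiv (Module.finrank K E.1) ∈ Set.range (layerInvS S hE) := by
    rw [mem_range_layerInvS_iff, smul_comm, nsmul_oneDiv, smul_zero]
  obtain ⟨c, hc⟩ := hmem
  refine ⟨LayerColimit.inflG (layerSubgroupS S E) (classBarSD K S) 2 c, ?_⟩
  rw [invS_inflG S hE, hc, ← hr, smul_comm, ← natCard_subgroupImageS_mul_index S hE hEU, mul_comm,
    nsmul_oneDiv_mul (Nat.pos_of_ne_zero (index_ne_zero_of_layerSubgroupS_le S hE hEU))]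

/-! ## §2. `invAt C̄_S inv_S U = inv_U` and the four fields of `TateDualityHypothesesAt p (C̄_S) inv_S` of this brick -/

/-- **`invAt (classBarSD K S) (invS S) U = invSAt S ↑U`**: the engine's local invariant map `inv_S ∘ cores_U` IS the descended
invariant map of the relative layers (w7's `inv_comp_extCores_eq_of_exists` from §1 and `invSAt_injective`).
[cite: MilneADT2006, I §1 (class formations, (1.1))][cite: Harari2020, §16.1 Def. 16.3, §16.4 Remark 16.24] -/
theorem invAt_classBarSD_apply (U : OpenNormalSubgroup (GaloisGroupUnramifiedOutside K (↑S : Set (HeightOneSpectrum (𝓞 K)))))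
    (y : Abelian.Ext (triv (k := ℤ) (Γ := (U : Subgroup (GaloisGroupUnramifiedOutside K (↑S : Set (HeightOneSpectrum (𝓞 K)))))) ℤ)
      ((DiscreteRep.resD ℤ (U : Subgroup (GaloisGroupUnramifiedOutside K (↑S : Set (HeightOneSpectrum (𝓞 K)))))).obj
        (classBarSD K S)) 2) :
    DiscreteRep.invAt (classBarSD K S) (invS S) U y =
      invSAt S (U : Subgroup (GaloisGroupUnramifiedOutside K (↑S : Set (HeightOneSpectrum (𝓞 K))))) U.toOpenSubgroup.isOpen y := by
  haveI := totallyDisconnectedSpace_GS S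
  haveI := finiteIndex_of_openNormalSubgroup U
  have h := inv_comp_extCores_eq_of_exists (U : Subgroup (GaloisGroupUnramifiedOutside K (↑S : Set (HeightOneSpectrum (𝓞 K)))))
    U.toOpenSubgroup.isOpen (classBarSD K S) (invS S) (invSAt S _ U.toOpenSubgroup.isOpen) (invSAt_extRes S U)
    (invSAt_injective S U.toOpenSubgroup.isOpen) (exists_invSAt_eq_index_nsmul_invS S U) y
  -- `invAt = inv ∘ cores` is a definition; unfold it rather than let `exact` search for the unfolding (which diverges here)
  unfold DiscreteRep.invAt
  rw [AddMonoidHom.comp_apply]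
  exact h

/-- **`invAt C̄_S inv_S U` on a class inflated from a relative layer IS the relative `S`-layer invariant `inv_{H_E}`** (the
class-module invariant of `(H_E, Res C_S(E))`, `H_E` the image of `U` in `Gal(E/K)`, read through w3's `relLayerSCohomologyIso`)
— the `S`-analogue of door-c4 g16's `classBarInvAt_inflG` + `invAt_classData_eq_classBarInvAt`, the interface bsd-line-x1-p1-w8's
D2-(b) (`α¹(U, ℤ/p^a)`) reads. [cite: SerreLocalFields1979, Ch. XI §3][cite: MilneADT2006, I §1 (1.1)] -/
theorem invAt_classBarSD_inflG (U : OpenNormalSubgroup (GaloisGroupUnramifiedOutside K (↑S : Set (HeightOneSpectrum (𝓞 K)))))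
    {E : GalLayer K} (hE : ramificationSubgroup K (↑S : Set (HeightOneSpectrum (𝓞 K))) ≤ galFixing K E.1)
    (hEU : (layerSubgroupS S E : Subgroup (GaloisGroupUnramifiedOutside K (↑S : Set (HeightOneSpectrum (𝓞 K))))) ≤ U)
    (c : groupCohomology (relLayerRepS S (U : Subgroup (GaloisGroupUnramifiedOutside K (↑S : Set (HeightOneSpectrum (𝓞 K))))) E) 2) :
    (haveI := totallyDisconnectedSpace_GS S
     DiscreteRep.invAt (classBarSD K S) (invS S) U
      (LayerColimit.inflG (DiscreteRep.traceOpenNormalSubgroup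
          (U : Subgroup (GaloisGroupUnramifiedOutside K (↑S : Set (HeightOneSpectrum (𝓞 K))))) (layerSubgroupS S E))
        ((DiscreteRep.resD ℤ (U : Subgroup (GaloisGroupUnramifiedOutside K (↑S : Set (HeightOneSpectrum (𝓞 K)))))).obj
          (classBarSD K S)) 2 c)) =
      (haveI := E.numberField; haveI := E.isGalois;
        (IdeleCohomology.isClassModule_classModUnitsCocycle (F := K) (E := E.1) S
          (forall_isUnramifiedIn_of_insideKS S hE)).invSub
          (subgroupImageS S hE (U : Subgroup (GaloisGroupUnramifiedOutside K (↑S : Set (HeightOneSpectrum (𝓞 K))))))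
          ((relLayerSCohomologyIso S hE hEU 2).hom c)) := by
  rw [invAt_classBarSD_apply, invSAt_inflG S _ hE hEU, relLayerInvS_apply]

/-- **FIELD `invAt_injective`**: `inv_S ∘ cores_U` is injective on `Ext²_{C_U}(ℤ, Res_U C̄_S)` for every open normal `U ≤ G_S`.
[cite: Harari2020, §16.4 Remark 16.24 (b), §17.1 Thm. 17.2][cite: MilneADT2006, I §1] -/
theorem invAt_classBarSD_injective
    (U : OpenNormalSubgroup (GaloisGroupUnramifiedOutside K (↑S : Set (HeightOneSpectrum (𝓞 K))))) :
    Function.Injective (DiscreteRep.invAt (classBarSD K S) (invS S) U) := by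
  intro y y' h
  rw [invAt_classBarSD_apply, invAt_classBarSD_apply] at h
  exact invSAt_injective S U.toOpenSubgroup.isOpen h

/-- **`p^∞ ∣ [U : V̄_E ∩ U]` along the relative layers** of an open `W ≤ G_S` (`S ⊇ S_p`; w7's
`exists_insideKS_le_pow_dvd_relindex`, the trace layer's index being the relative index).
[cite: Harari2020, §17.1 Remark 17.1][cite: NeukirchSchmidtWingberg2008, VIII §3 (8.3.11) (proof)] -/
theorem exists_pow_dvd_index_relTraceS {p : ℕ} [Fact p.Prime]
    (hSp : ∀ v : HeightOneSpectrum (𝓞 K), ((p : ℕ) : 𝓞 K) ∈ v.asIdeal → v ∈ (↑S : Set (HeightOneSpectrum (𝓞 K))))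
    (W : Subgroup (GaloisGroupUnramifiedOutside K (↑S : Set (HeightOneSpectrum (𝓞 K)))))
    (hW : IsOpen (W : Set (GaloisGroupUnramifiedOutside K (↑S : Set (HeightOneSpectrum (𝓞 K)))))) (a : ℕ) :
    ∃ E : RelLayerKS S W, p ^ a ∣ (relTraceS S W E : Subgroup W).index := by
  obtain ⟨E, hE, hEW, hdvd⟩ := OpenSubgroupLayer.exists_insideKS_le_pow_dvd_relindex (↑S : Set (HeightOneSpectrum (𝓞 K))) p
    hSp W hW a
  exact ⟨⟨⟨E, hE⟩, hEW⟩, hdvd⟩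

/-- **The `p`-power torsion of `ℚ/ℤ` is in the range of `inv_W`** for every open `W ≤ G_S` (`S ⊇ S_p`).
[cite: Harari2020, §16.4 Remark 16.24 (b), §17.1 Remark 17.1][cite: MilneADT2006, I §4] -/
theorem exists_invSAt_eq_of_pow_nsmul_eq_zero {p : ℕ} [Fact p.Prime]
    (hSp : ∀ v : HeightOneSpectrum (𝓞 K), ((p : ℕ) : 𝓞 K) ∈ v.asIdeal → v ∈ (↑S : Set (HeightOneSpectrum (𝓞 K))))
    (W : Subgroup (GaloisGroupUnramifiedOutside K (↑S : Set (HeightOneSpectrum (𝓞 K)))))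
    (hW : IsOpen (W : Set (GaloisGroupUnramifiedOutside K (↑S : Set (HeightOneSpectrum (𝓞 K)))))) (a : ℕ) (q : AddCircle (1 : ℚ))
    (hq : p ^ a • q = 0) : ∃ y, invSAt S W hW y = q := by
  haveI := totallyDisconnectedSpace_GS S
  haveI : CompactSpace W := LayerColimit.compactSpace_subgroup_of_isOpen W hW
  exact exists_desc_eq_of_pow_nsmul_eq_zero (relTraceS S W) ((DiscreteRep.resD ℤ W).obj (classBarSD K S))
    (fun E => relLayerInvS S E.1.2 E.2) (isCompatibleFamily_relLayerInvS S W hW)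
    (fun E q hq => (mem_range_relLayerInvS_iff_index S E.1.2 E.2 q).2 hq) (exists_pow_dvd_index_relTraceS S hSp W hW) a q hq

/-- **FIELD `exists_invAt_eq`**: every `p`-power-torsion element of `ℚ/ℤ` is a value of `inv_S ∘ cores_U`, for every open
normal `U ≤ G_S` (`S ⊇ S_p`). [cite: Harari2020, §16.4 Remark 16.24 (b), §17.1 Remark 17.1][cite: MilneADT2006, I §4] -/
theorem exists_invAt_classBarSD_eq {p : ℕ} [Fact p.Prime]
    (hSp : ∀ v : HeightOneSpectrum (𝓞 K), ((p : ℕ) : 𝓞 K) ∈ v.asIdeal → v ∈ (↑S : Set (HeightOneSpectrum (𝓞 K))))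
    (U : OpenNormalSubgroup (GaloisGroupUnramifiedOutside K (↑S : Set (HeightOneSpectrum (𝓞 K))))) (a : ℕ)
    (q : AddCircle (1 : ℚ)) (hq : p ^ a • q = 0) : ∃ x, DiscreteRep.invAt (classBarSD K S) (invS S) U x = q := by
  obtain ⟨y, hy⟩ := exists_invSAt_eq_of_pow_nsmul_eq_zero S hSp _ U.toOpenSubgroup.isOpen a q hq
  exact ⟨y, (invAt_classBarSD_apply S U y).trans hy⟩

/-- **FIELD `ext_triv_divisible` AT `r = 2`**: `Ext²_{C_W}(ℤ, Res_W C̄_S) = H²(W, C̄_S)` is `p`-divisible for every open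
`W ≤ G_S` (`S ⊇ S_p`; w7's `exists_eq_nsmul_of_layers` on the relative layer family: `x = Inf_E c`, `inv c = a/|H_E|`, and
`a/(p|H_E|)` is an invariant at a deeper layer). [cite: Harari2020, §16.4 Remark 16.24 (b)][cite: MilneADT2006, I §1 and §4] -/
theorem exists_eq_nsmul_resD_classBarSD {p : ℕ} [Fact p.Prime]
    (hSp : ∀ v : HeightOneSpectrum (𝓞 K), ((p : ℕ) : 𝓞 K) ∈ v.asIdeal → v ∈ (↑S : Set (HeightOneSpectrum (𝓞 K))))
    (W : Subgroup (GaloisGroupUnramifiedOutside K (↑S : Set (HeightOneSpectrum (𝓞 K)))))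
    (hW : IsOpen (W : Set (GaloisGroupUnramifiedOutside K (↑S : Set (HeightOneSpectrum (𝓞 K))))))
    (x : Abelian.Ext (triv (k := ℤ) (Γ := W) ℤ) ((DiscreteRep.resD ℤ W).obj (classBarSD K S)) 2) : ∃ y, x = p • y := by
  haveI := totallyDisconnectedSpace_GS S
  haveI : CompactSpace W := LayerColimit.compactSpace_subgroup_of_isOpen W hW
  exact exists_eq_nsmul_of_layers (relTraceS S W) ((DiscreteRep.resD ℤ W).obj (classBarSD K S))
    (fun E => relLayerInvS S E.1.2 E.2) (Fact.out : p.Prime) (isCompatibleFamily_relLayerInvS S W hW)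
    (fun E => relLayerInvS_injective S E.1.2 E.2) (fun E q => mem_range_relLayerInvS_iff_index S E.1.2 E.2 q)
    (exists_pow_dvd_index_relTraceS S hSp W hW) x

/-- **`H¹` of every relative layer vanishes**: `H¹(↥W ⧸ (V̄_E ∩ W), (Res_W C̄_S)^{V̄_E ∩ W}) ≅ H¹(H_E, Res C_S(E)) = 0`
(w4 g16's `isZero_H1_res_classModUnits` through w3's `relLayerSCohomologyIso`).
[cite: Harari2020, §17.1 Thm. 17.2 (proof)][cite: MilneADT2006, I §4] -/
theorem relLayer_H1_eq_zero {W : Subgroup (GaloisGroupUnramifiedOutside K (↑S : Set (HeightOneSpectrum (𝓞 K))))}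
    {E : GalLayer K} (hE : ramificationSubgroup K (↑S : Set (HeightOneSpectrum (𝓞 K))) ≤ galFixing K E.1)
    (hEW : (layerSubgroupS S E : Subgroup (GaloisGroupUnramifiedOutside K (↑S : Set (HeightOneSpectrum (𝓞 K))))) ≤ W)
    (c : groupCohomology (relLayerRepS S W E) 1) : c = 0 := by
  haveI := E.numberField
  haveI := E.isGalois
  have h1 : IsZero (groupCohomology
      (Rep.res (subgroupImageS S hE W).subtype (IdeleCohomology.classModUnitsRep K E.1 S)) 1) :=
    IdeleCohomology.isZero_H1_res_classModUnits S (forall_isUnramifiedIn_of_insideKS S hE) (subgroupImageS S hE W)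
  have h2 : IsZero (groupCohomology (relLayerRepS S W E) 1) := h1.of_iso (relLayerSCohomologyIso S hE hEW 1)
  haveI := ModuleCat.subsingleton_of_isZero h2
  exact Subsingleton.elim _ _

/-- **FIELD `ext_one_eq_zero`**: `Ext¹_{C_W}(ℤ, Res_W C̄_S) = H¹(W, C̄_S) = 0` for every open `W ≤ G_S` (w7's
`ext_one_eq_zero_of_layers` on the relative layer family). [cite: Harari2020, §16.1 Def. 16.1, §17.1 Thm. 17.2][cite: MilneADT2006, I §4] -/
theorem ext_one_eq_zero_resD_classBarSD
    (W : Subgroup (GaloisGroupUnramifiedOutside K (↑S : Set (HeightOneSpectrum (𝓞 K)))))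
    (hW : IsOpen (W : Set (GaloisGroupUnramifiedOutside K (↑S : Set (HeightOneSpectrum (𝓞 K))))))
    (x : Abelian.Ext (triv (k := ℤ) (Γ := W) ℤ) ((DiscreteRep.resD ℤ W).obj (classBarSD K S)) 1) : x = 0 := by
  haveI := totallyDisconnectedSpace_GS S
  haveI : CompactSpace W := LayerColimit.compactSpace_subgroup_of_isOpen W hW
  exact ext_one_eq_zero_of_layers (relTraceS S W) ((DiscreteRep.resD ℤ W).obj (classBarSD K S))
    (isCompatibleFamily_relLayerInvS S W hW).cofinal (fun E c => relLayer_H1_eq_zero S E.1.2 E.2 c) x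

/-- **THE FOUR FIELDS OF BRICK D2-CF, packaged for the engine's quantifier `U : OpenNormalSubgroup G_S`** (`S ⊇ S_p`):
`invAt_injective`, `exists_invAt_eq`, `ext_one_eq_zero`, and `ext_triv_divisible` at `r = 2`, for
`TateDualityHypothesesAt p (classBarSD K S) (invS S)` (the `r ≥ 3` divisibility / torsion-freeness, `α¹(U, ℤ/p^a)`, `baer`,
`ext_one_triv_eq_zero`, Lemma 1.9 are the other bricks' and the constructor's).
[cite: Harari2020, §17.1 Thm. 17.2, §16.4 Remark 16.24 (b)][cite: MilneADT2006, I §1, §4] -/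
theorem tateDualityHypothesesAt_classBarSD_fields {p : ℕ} [Fact p.Prime]
    (hSp : ∀ v : HeightOneSpectrum (𝓞 K), ((p : ℕ) : 𝓞 K) ∈ v.asIdeal → v ∈ (↑S : Set (HeightOneSpectrum (𝓞 K)))) :
    (∀ U : OpenNormalSubgroup (GaloisGroupUnramifiedOutside K (↑S : Set (HeightOneSpectrum (𝓞 K)))),
        Function.Injective (DiscreteRep.invAt (classBarSD K S) (invS S) U)) ∧
      (∀ (U : OpenNormalSubgroup (GaloisGroupUnramifiedOutside K (↑S : Set (HeightOneSpectrum (𝓞 K))))) (a : ℕ)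
        (q : AddCircle (1 : ℚ)), p ^ a • q = 0 → ∃ x, DiscreteRep.invAt (classBarSD K S) (invS S) U x = q) ∧
      (∀ (U : OpenNormalSubgroup (GaloisGroupUnramifiedOutside K (↑S : Set (HeightOneSpectrum (𝓞 K)))))
        (x : Abelian.Ext (triv (k := ℤ) (Γ := (U : Subgroup (GaloisGroupUnramifiedOutside K (↑S : Set (HeightOneSpectrum (𝓞 K)))))) ℤ)
          ((DiscreteRep.resD ℤ (U : Subgroup (GaloisGroupUnramifiedOutside K (↑S : Set (HeightOneSpectrum (𝓞 K)))))).obj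
            (classBarSD K S)) 1), x = 0) ∧
      (∀ (U : OpenNormalSubgroup (GaloisGroupUnramifiedOutside K (↑S : Set (HeightOneSpectrum (𝓞 K)))))
        (x : Abelian.Ext (triv (k := ℤ) (Γ := (U : Subgroup (GaloisGroupUnramifiedOutside K (↑S : Set (HeightOneSpectrum (𝓞 K)))))) ℤ)
          ((DiscreteRep.resD ℤ (U : Subgroup (GaloisGroupUnramifiedOutside K (↑S : Set (HeightOneSpectrum (𝓞 K)))))).obj
            (classBarSD K S)) 2), ∃ y, x = p • y) :=
  ⟨fun U => invAt_classBarSD_injective S U,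
   fun U a q hq => exists_invAt_classBarSD_eq S hSp U a q hq,
   fun U x => ext_one_eq_zero_resD_classBarSD S _ U.toOpenSubgroup.isOpen x,
   fun U x => exists_eq_nsmul_resD_classBarSD S hSp _ U.toOpenSubgroup.isOpen x⟩

end IdeleClassBar

end Literature.NumberTheory.GaloisRepresentations

end
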